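import Literature.Barriers.ABC.BakerMethodBoundsYuInputProofs
import Literature.NumberTheory.DiophantineGeometry.SmallMultiplicativeRelation
import Summits.ABC.StewartYu.ShapeDepElimPrelims
import HarnessLib

/-!
# Cell abc-stewartyu — draft route `YuMatveevShapeRat` (plan-m3 g2, HOME/plan-m3/next/SketchGA.lean):
# the `p`-adic DEPENDENCE-REMOVAL step in SHAPE form, odd `p`, proved

Cell `abc-stewartyu` (HOME `run/shared/lean/pub/abc-stewartyu/`; seat `lit-abc-yu2007` g3). Theorems only;
no definition, no named fact, nothing closed. Twin of `ArchShapeDepElim.lean` at an odd prime: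
`padicShape_dep_of_indep_odd` — if, for some real `c`, the Kummer-free `p`-adic SHAPE bound
`ord_p(∏ θᵢ^{mᵢ} − 1) log p ≤ cʳ (p/log p) ∏Aᵢ (W + log p + log 2A_max)` holds, uniformly in the odd
prime `p`, for all MULTIPLICATIVELY INDEPENDENT rational `p`-adic units `θ : Fin r → ℚ` (`h(θᵢ) ≤ Aᵢ`,
`1 ≤ Aᵢ ≤ A_max`, `m ≠ 0`, `log max(3,|mᵢ|) ≤ W`, `1 ≤ W`) — the planner's text of the crux
`PadicCoreOddRat`, verbatim — then with `c' = max |c| 20` it holds for ALL rational `p`-adic units as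
soon as `∏ θᵢ^{mᵢ} ≠ 1`: the "dependence removal" ingredient of the draft item `PadicShapeChain`.

Method (Matveev 2000 §21 / the tree's `yu2007_padicLogForm_rat_of_core''`, in shape currency; one
relation at a time): strong induction on the number of units; the `p`-adic Liouville estimate
`ord_p(Ξ − 1) log p ≤ log 2 + ∑|mᵢ|h(θᵢ) ≤ log 2 + n e^W A_max` (`padicValRat_mul_log_le_logHeight₁`)
either settles the bound or gives (†) `c'ⁿ ∏_{k≠k*} Aₖ < 2n e^W` for an index `k*` of maximal weight;
a dependence yields a small relation `∏ θₖ^{2tₖ} = 1` on a minimal support `S`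
(`exists_small_mult_relation`); the index eliminated is `k*` if `k* ∈ S`, else any `j ∈ S`, so the
relation size `R = 2∏_{l∈S∖j} 3A_l` is `≤ e^W` by (†); the valuation transfers along the relation
(`yu2007_dep_transfer`: `ord_p(Ξ − 1) ≤ ord_p(Ξ^{2tⱼ} − 1)` or `≤ 1`), the new exponents are
`≤ 2RAⱼe^W`, so `W' ≤ 2W + Aⱼ`, the `Aⱼ` being paid by the freed factor `Aⱼ`. DESIGN NOTE for the
planner: the one-relation-at-a-time elimination IS `cⁿ`-safe in this currency (no saturated basis /
Loher–Masser is needed for DEPENDENCE removal; saturation remains the device for Kummer removal inside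
the core). WHAT THIS IS NOT: no analytic estimate; no crux moved; no abc claim.
References: [Matveev2000] Izv. Math. 64 (2000) 1217–1269, §21; [Yu2007] Forum Math. 19 (2007) 187–280, §1
(the `p`-adic core); [EvertseGyory2015] pp. 80–81.
-/

open Height Real Finset
open Literature.NumberTheory.DiophantineGeometry.Dioph

noncomputable section

namespace Summit.ABC.StewartYu

namespace PadicShapeDepElim

open ShapeDepElim

set_option maxHeartbeats 400000 in
/-- The dependence removal at an odd prime on a general finite index type (strong induction on its
size). [cite: Matveev2000, §21 (pp. 173–176)] -/
theorem dep_elim_odd {C : ℝ} (hC : 20 ≤ C)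
    (hcore : ∀ (κ : Type) [Fintype κ], ∀ (p : ℕ), p.Prime → p ≠ 2 →
      ∀ (θ : κ → ℚ) (b : κ → ℤ) (A : κ → ℝ) (Amax W : ℝ),
      (∀ k, θ k ≠ 0 ∧ padicValRat p (θ k) = 0) → (∀ μ : κ → ℤ, ∏ k, θ k ^ μ k = 1 → μ = 0) →
      (∀ k, logHeight₁ (θ k) ≤ A k) → (∀ k, (1 : ℝ) ≤ A k) → (∀ k, A k ≤ Amax) → b ≠ 0 →
      (∀ k, Real.log (max 3 |(b k : ℝ)|) ≤ W) → 1 ≤ W →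
      (padicValRat p (∏ k, θ k ^ b k - 1) : ℝ) * Real.log p ≤
        C ^ Fintype.card κ * ((p : ℝ) / Real.log p) * (∏ k, A k) *
          (W + Real.log p + Real.log (2 * Amax)))
    (n : ℕ) :
    ∀ (κ : Type) [Fintype κ], Fintype.card κ = n → ∀ (p : ℕ), p.Prime → p ≠ 2 →
      ∀ (θ : κ → ℚ) (b : κ → ℤ) (A : κ → ℝ) (Amax W : ℝ),
      (∀ k, θ k ≠ 0 ∧ padicValRat p (θ k) = 0) →
      (∀ k, logHeight₁ (θ k) ≤ A k) → (∀ k, (1 : ℝ) ≤ A k) → (∀ k, A k ≤ Amax) →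
      (∀ k, Real.log (max 3 |(b k : ℝ)|) ≤ W) → 1 ≤ W → ∏ k, θ k ^ b k ≠ 1 →
      (padicValRat p (∏ k, θ k ^ b k - 1) : ℝ) * Real.log p ≤
        C ^ n * ((p : ℝ) / Real.log p) * (∏ k, A k) * (W + Real.log p + Real.log (2 * Amax)) := by
  induction n using Nat.strong_induction_on with
  | _ n IH =>
  intro κ _ hcard p hp hp2 θ b A Amax W hu hAh hA1 hAm hbW hW1 hΞ
  classical
  haveI : Fact p.Prime := ⟨hp⟩
  have hb : b ≠ 0 := by rintro rfl; exact hΞ (by simp)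
  obtain ⟨k₁, hk₁⟩ : ∃ k, b k ≠ 0 := by by_contra h; push Not at h; exact hb (funext h)
  obtain ⟨m, rfl⟩ : ∃ m, n = m + 1 :=
    ⟨n - 1, by have : 0 < n := hcard ▸ Fintype.card_pos_iff.mpr ⟨k₁⟩; omega⟩
  have hA0 : ∀ k, 0 < A k := fun k => lt_of_lt_of_le one_pos (hA1 k)
  have hAmax : 1 ≤ Amax := (hA1 k₁).trans (hAm k₁)
  have hp1 : (1 : ℝ) < p := by exact_mod_cast hp.one_lt
  have hlogp : 0 < Real.log p := Real.log_pos hp1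
  have hlogp' : Real.log p ≤ p := (Real.log_le_sub_one_of_pos (by linarith)).trans (by linarith)
  have hq1 : 1 ≤ (p : ℝ) / Real.log p := by rw [le_div_iff₀ hlogp]; linarith
  have hL2A : 0 ≤ Real.log (2 * Amax) := Real.log_nonneg (by linarith)
  set G := W + Real.log p + Real.log (2 * Amax) with hG
  have hG1 : 1 ≤ G := by rw [hG]; linarith
  have hGp : Real.log p ≤ G := by rw [hG]; linarith
  have hC0 : 0 < C := by linarith
  have heW : Real.exp 1 ≤ Real.exp W := Real.exp_le_exp.mpr hW1
  have he1 := Real.exp_one_gt_d9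
  have hbE : ∀ k, |(b k : ℝ)| ≤ Real.exp W := fun k => abs_le_exp_of_log_max_le (hbW k)
  obtain ⟨ks, -, hks⟩ := Finset.exists_max_image univ A (univ_nonempty_iff.mpr ⟨k₁⟩)
  have hks' : ∀ k, A k ≤ A ks := fun k => hks k (mem_univ k)
  set P := ∏ k ∈ univ.erase ks, A k with hP
  have hP1 : 1 ≤ P := by
    rw [hP, ← Finset.prod_const_one (s := univ.erase ks)]
    exact Finset.prod_le_prod (fun _ _ => zero_le_one) fun k _ => hA1 k
  have hsplit : ∏ k, A k = A ks * P := (Finset.mul_prod_erase univ A (mem_univ ks)).symm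
  -- (L) Liouville: `ord_p(Ξ − 1) log p ≤ log 2 + ∑|bₖ|h(θₖ) ≤ log 2 + (m+1) e^W A_{ks}`
  have hLiou : (padicValRat p (∏ k, θ k ^ b k - 1) : ℝ) * Real.log p ≤
      Real.log 2 + ((m : ℝ) + 1) * Real.exp W * A ks := by
    have h1 := padic_liouville hp θ b hΞ
    have h2 : ∑ k, |(b k : ℝ)| * logHeight₁ (θ k) ≤ ∑ _k : κ, Real.exp W * A ks := by
      refine Finset.sum_le_sum fun k _ => ?_
      exact mul_le_mul (hbE k) ((hAh k).trans (hks' k)) (Height.zero_le_logHeight₁ _)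
        (Real.exp_pos W).le
    rw [Finset.sum_const, card_univ, hcard, nsmul_eq_mul] at h2
    push_cast at h2
    linarith
  by_cases hLcase : Real.log 2 + ((m : ℝ) + 1) * Real.exp W * A ks ≤
      C ^ (m + 1) * ((p : ℝ) / Real.log p) * (∏ k, A k) * G
  · exact hLiou.trans hLcase
  -- (†) `C^{m+1} P < 2 (m+1) e^W`
  have hdag : C ^ (m + 1) * P < 2 * ((m : ℝ) + 1) * Real.exp W := by
    push Not at hLcase
    rw [hsplit] at hLcase
    have hl2 : Real.log 2 ≤ ((m : ℝ) + 1) * Real.exp W * A ks := by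
      have h1 : Real.log 2 < 1 := by have := Real.log_two_lt_d9; linarith
      have h2 : (1 : ℝ) * 1 * 1 ≤ ((m : ℝ) + 1) * Real.exp W * A ks :=
        mul_le_mul (mul_le_mul (by simp) (by linarith) zero_le_one (by positivity)) (hA1 ks)
          zero_le_one (by positivity)
      linarith
    have h3 : C ^ (m + 1) * P * 1 * 1 * A ks ≤ C ^ (m + 1) * P * ((p : ℝ) / Real.log p) * G * A ks :=
      mul_le_mul_of_nonneg_right (mul_le_mul (mul_le_mul_of_nonneg_left hq1 (by positivity)) hG1
        zero_le_one (by positivity)) (hA0 ks).le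
    have h4 : C ^ (m + 1) * ((p : ℝ) / Real.log p) * (A ks * P) * G =
        C ^ (m + 1) * P * ((p : ℝ) / Real.log p) * G * A ks := by ring
    have h5 : (C ^ (m + 1) * P) * A ks < (2 * ((m : ℝ) + 1) * Real.exp W) * A ks := by nlinarith
    exact lt_of_mul_lt_mul_right h5 (hA0 ks).le
  by_cases hind : ∀ μ : κ → ℤ, ∏ k, θ k ^ μ k = 1 → μ = 0
  · -- independent: the core
    have h := hcore κ p hp hp2 θ b A Amax W hu hind hAh hA1 hAm hb hbW hW1
    rwa [hcard] at h
  -- dependent: a small relation on a minimal support `S`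
  push Not at hind
  obtain ⟨μ, hμ, hμ0⟩ := hind
  obtain ⟨S, t, hSne, hsupp, htrel, hbd⟩ := exists_small_mult_relation (fun k => (hu k).1) hμ0 hμ
  obtain ⟨j, hj, hT⟩ := exists_elim_index hSne ks
  have htj : t j ≠ 0 := (hsupp j).mpr hj
  have hrj : (2 * t j : ℤ) ≠ 0 := mul_ne_zero two_ne_zero htj
  -- the size of the relation: `R = 2 ∏_{S∖j} 3A ≤ 2·3^m·P ≤ e^W`
  set R := 2 * ∏ l ∈ S.erase j, (3 * A l) with hR
  obtain ⟨hRj, hRk⟩ := relation_bounds hAh hbd hj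
  have hU : (univ.erase ks).card = m := by
    rw [Finset.card_erase_of_mem (mem_univ ks), card_univ, hcard]; rfl
  have hR1 : 1 ≤ R := by
    have : (1 : ℝ) ≤ |((2 * t j : ℤ) : ℝ)| := by rw [← Int.cast_abs]; exact_mod_cast Int.one_le_abs hrj
    linarith
  have hRE : R ≤ Real.exp W := by
    have h1 : ∏ l ∈ S.erase j, (3 * A l) ≤ (3 : ℝ) ^ m * P := by
      have := prod_three_mul_le hA1 hT; rwa [hU] at this
    have h2 : 6 * ((m : ℝ) + 1) * (3 : ℝ) ^ m ≤ C ^ (m + 1) := six_mul_three_pow_le hC m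
    have h3m : 0 ≤ (3 : ℝ) ^ m := by positivity
    have h3 : R * C ^ (m + 1) ≤ Real.exp W * C ^ (m + 1) := by
      calc R * C ^ (m + 1) ≤ (2 * ((3 : ℝ) ^ m * P)) * C ^ (m + 1) :=
            mul_le_mul_of_nonneg_right (by rw [hR]; linarith) (by positivity)
        _ = 2 * (3 : ℝ) ^ m * (C ^ (m + 1) * P) := by ring
        _ ≤ 2 * (3 : ℝ) ^ m * (2 * ((m : ℝ) + 1) * Real.exp W) :=
            mul_le_mul_of_nonneg_left hdag.le (by positivity)
        _ = (4 * ((m : ℝ) + 1) * 3 ^ m) * Real.exp W := by ring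
        _ ≤ (6 * ((m : ℝ) + 1) * 3 ^ m) * Real.exp W := by
            apply mul_le_mul_of_nonneg_right _ (Real.exp_pos W).le; nlinarith
        _ ≤ C ^ (m + 1) * Real.exp W := mul_le_mul_of_nonneg_right h2 (Real.exp_pos W).le
        _ = Real.exp W * C ^ (m + 1) := by ring
    exact le_of_mul_le_mul_right h3 (by positivity)
  -- the new exponents `b'ₖ = 2tⱼ bₖ − 2tₖ bⱼ` are `≤ 2 R Aⱼ e^W`; the new `W' = W + log(2RAⱼ)`
  have hAj := hA1 j
  set W' := W + Real.log (2 * R * A j) with hW'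
  have hM3 : (3 : ℝ) ≤ 2 * R * A j * Real.exp W := by
    have h := mul_le_mul (one_le_mul_of_one_le_of_one_le hR1 hAj) (show (2 : ℝ) ≤ Real.exp W by linarith)
      zero_le_two (by nlinarith)
    linarith
  have hbW' : ∀ k : {k // k ≠ j},
      Real.log (max 3 |((2 * t j * b k.val - 2 * t k.val * b j : ℤ) : ℝ)|) ≤ W' := by
    intro k
    have h1 : |((2 * t j : ℤ) : ℝ)| * |(b k.val : ℝ)| ≤ R * Real.exp W :=
      mul_le_mul hRj (hbE k.val) (abs_nonneg _) (by linarith)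
    have h2 : |((2 * t k.val : ℤ) : ℝ)| * |(b j : ℝ)| ≤ R * A j * Real.exp W := by
      by_cases hkS : k.val ∈ S
      · have h3 : |((2 * t k.val : ℤ) : ℝ)| ≤ R * A j := by
          have h4 := hRk k.val hkS
          have h5 : |((2 * t k.val : ℤ) : ℝ)| * 1 ≤ |((2 * t k.val : ℤ) : ℝ)| * A k.val :=
            mul_le_mul_of_nonneg_left (hA1 _) (abs_nonneg _)
          linarith
        exact mul_le_mul h3 (hbE j) (abs_nonneg _) (by nlinarith)
      · have htk : t k.val = 0 := by by_contra h; exact hkS ((hsupp _).mp h)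
        rw [htk, mul_zero, Int.cast_zero, abs_zero, zero_mul]
        exact mul_nonneg (mul_nonneg (by linarith) (by linarith)) (Real.exp_pos W).le
    have h6 : |((2 * t j * b k.val - 2 * t k.val * b j : ℤ) : ℝ)| ≤ 2 * R * A j * Real.exp W := by
      have h3 : R * Real.exp W * 1 ≤ R * Real.exp W * A j :=
        mul_le_mul_of_nonneg_left hAj (mul_nonneg (by linarith) (Real.exp_pos W).le)
      calc |((2 * t j * b k.val - 2 * t k.val * b j : ℤ) : ℝ)|
          = |((2 * t j : ℤ) : ℝ) * (b k.val : ℝ) - ((2 * t k.val : ℤ) : ℝ) * (b j : ℝ)| := by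
            push_cast; ring_nf
        _ ≤ |((2 * t j : ℤ) : ℝ) * (b k.val : ℝ)| + |((2 * t k.val : ℤ) : ℝ) * (b j : ℝ)| := abs_sub _ _
        _ = |((2 * t j : ℤ) : ℝ)| * |(b k.val : ℝ)| + |((2 * t k.val : ℤ) : ℝ)| * |(b j : ℝ)| := by
            rw [abs_mul, abs_mul]
        _ ≤ R * Real.exp W + R * A j * Real.exp W := add_le_add h1 h2
        _ ≤ 2 * R * A j * Real.exp W := by linarith
    have h7 : max 3 |((2 * t j * b k.val - 2 * t k.val * b j : ℤ) : ℝ)| ≤ 2 * R * A j * Real.exp W :=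
      max_le hM3 h6
    have h8 : 0 < max 3 |((2 * t j * b k.val - 2 * t k.val * b j : ℤ) : ℝ)| :=
      lt_of_lt_of_le (by norm_num) (le_max_left _ _)
    calc Real.log (max 3 |((2 * t j * b k.val - 2 * t k.val * b j : ℤ) : ℝ)|)
        ≤ Real.log (2 * R * A j * Real.exp W) := Real.log_le_log h8 h7
      _ = W' := by
          rw [hW', Real.log_mul (by positivity) (Real.exp_pos W).ne', Real.log_exp]; ring
  have hRpos : 0 < 2 * R * A j := by positivity
  have hlog2R : 0 ≤ Real.log (2 * R * A j) := Real.log_nonneg (by nlinarith)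
  have hW'1 : 1 ≤ W' := by rw [hW']; linarith
  have hW'le : W' ≤ 2 * W + A j := by
    have h1 : Real.log (2 * R * A j) = Real.log 2 + Real.log R + Real.log (A j) := by
      rw [Real.log_mul (by positivity) (hA0 j).ne', Real.log_mul (by norm_num) (by positivity)]
    have h2 : Real.log R ≤ W := by
      have := Real.log_le_log (by linarith) hRE; rwa [Real.log_exp] at this
    have h3 : Real.log 2 ≤ 1 := by have := Real.log_two_lt_d9; linarith
    have h4 : Real.log (A j) ≤ A j - 1 := Real.log_le_sub_one_of_pos (hA0 j)
    rw [hW', h1]; linarith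
  -- transfer of the valuation along the relation, induction hypothesis for the `m` units `k ≠ j`
  have hΛ0 : ∏ k, θ k ^ b k - 1 ≠ 0 := sub_ne_zero.mpr hΞ
  have hRHSp : Real.log p ≤ C ^ (m + 1) * ((p : ℝ) / Real.log p) * (∏ k, A k) * G := by
    have h1 : (1 : ℝ) ≤ C ^ (m + 1) := one_le_pow₀ (by linarith)
    have h2 : (1 : ℝ) ≤ ∏ k, A k := by
      rw [hsplit]; exact one_le_mul_of_one_le_of_one_le (hA1 ks) hP1
    have h3 : (1 : ℝ) ≤ C ^ (m + 1) * ((p : ℝ) / Real.log p) * ∏ k, A k :=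
      one_le_mul_of_one_le_of_one_le (one_le_mul_of_one_le_of_one_le h1 hq1) h2
    have h4 : 1 * G ≤ (C ^ (m + 1) * ((p : ℝ) / Real.log p) * ∏ k, A k) * G :=
      mul_le_mul_of_nonneg_right h3 (by linarith)
    linarith
  rcases Literature.Barriers.ABC.yu2007_dep_transfer (fun k => (hu k).1) (fun k => (hu k).2) b htrel
    (j := j) hrj hΛ0 with hle1 | ⟨hΞ'ne, hle⟩
  · -- `ord_p Λ ≤ 1`: the bound is at least `log p`
    have h1 : (padicValRat p (∏ k, θ k ^ b k - 1) : ℝ) * Real.log p ≤ 1 * Real.log p :=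
      mul_le_mul_of_nonneg_right (by exact_mod_cast hle1) hlogp.le
    linarith
  have hcard' : Fintype.card {k // k ≠ j} = m := card_subtype_ne j hcard
  have hΞ' : ∏ k : {k // k ≠ j}, θ k.val ^ (2 * t j * b k.val - 2 * t k.val * b j) ≠ 1 := by
    rw [prod_subtype_ne j (fun k => θ k ^ (2 * t j * b k - 2 * t k * b j))]; exact sub_ne_zero.mp hΞ'ne
  have hI := IH m (lt_add_one m) {k // k ≠ j} hcard' p hp hp2 (fun k => θ k.val)
    (fun k => 2 * t j * b k.val - 2 * t k.val * b j) (fun k => A k.val) Amax W' (fun k => hu k.val)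
    (fun k => hAh k.val) (fun k => hA1 k.val) (fun k => hAm k.val) hbW' hW'1 hΞ'
  rw [prod_subtype_ne j (fun k => θ k ^ (2 * t j * b k - 2 * t k * b j)), prod_subtype_ne j A] at hI
  set Pj := ∏ k ∈ univ.erase j, A k with hPj
  have hPj1 : 1 ≤ Pj := by
    rw [hPj, ← Finset.prod_const_one (s := univ.erase j)]
    exact Finset.prod_le_prod (fun _ _ => zero_le_one) fun k _ => hA1 k
  have hsplitj : ∏ k, A k = A j * Pj := (Finset.mul_prod_erase univ A (mem_univ j)).symm
  have hle' : (padicValRat p (∏ k, θ k ^ b k - 1) : ℝ) * Real.log p ≤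
      (padicValRat p (∏ k ∈ univ.erase j, θ k ^ (2 * t j * b k - 2 * t k * b j) - 1) : ℝ) *
        Real.log p := mul_le_mul_of_nonneg_right (by exact_mod_cast hle) hlogp.le
  -- numerics: `C^m q Pj (W' + log p + L) ≤ C^m q Pj G (2 + Aⱼ) ≤ C^{m+1} q (Aⱼ Pj) G`
  rw [hsplitj]
  set q := (p : ℝ) / Real.log p with hq
  set X := C ^ m * q * Pj with hX
  have hX0 : 0 ≤ X := by positivity
  have h1a : A j * 1 ≤ A j * G := mul_le_mul_of_nonneg_left hG1 (hA0 j).le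
  have h1 : W' + Real.log p + Real.log (2 * Amax) ≤ G * (2 + A j) := by
    linarith [hW'le, hlogp.le, hL2A, h1a, hG]
  have h2 : X * (W' + Real.log p + Real.log (2 * Amax)) ≤ X * (G * (2 + A j)) :=
    mul_le_mul_of_nonneg_left h1 hX0
  have h3 : 2 + A j ≤ C * A j := by
    have h3a : 19 * A j ≤ (C - 1) * A j := mul_le_mul_of_nonneg_right (by linarith) (hA0 j).le
    linarith
  have h4 : X * (G * (2 + A j)) ≤ X * (G * (C * A j)) :=
    mul_le_mul_of_nonneg_left (mul_le_mul_of_nonneg_left h3 (zero_le_one.trans hG1)) hX0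
  have h5 : C ^ (m + 1) * q * (A j * Pj) * G = X * (G * (C * A j)) := by rw [hX]; ring
  rw [h5]
  exact hle'.trans (hI.trans (h2.trans h4))

/-- From the `Fin r`-indexed core to every finite index type, constant `max |c| 20`. [folklore] -/
theorem core_fintype_odd {c : ℝ}
    (hc : ∀ (p : ℕ), p.Prime → p ≠ 2 →
      ∀ (r : ℕ) (θ : Fin r → ℚ) (m : Fin r → ℤ) (A : Fin r → ℝ) (Amax W : ℝ),
      (∀ i, θ i ≠ 0 ∧ padicValRat p (θ i) = 0) →
      (∀ μ : Fin r → ℤ, ∏ i, θ i ^ μ i = 1 → μ = 0) →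
      (∀ i, Height.logHeight₁ (θ i) ≤ A i) → (∀ i, 1 ≤ A i) → (∀ i, A i ≤ Amax) →
      m ≠ 0 → (∀ i, Real.log (max 3 (|m i| : ℝ)) ≤ W) → 1 ≤ W →
      (padicValRat p (∏ i, θ i ^ m i - 1) : ℝ) * Real.log p ≤
        c ^ r * ((p : ℝ) / Real.log p) * (∏ i, A i) * (W + Real.log p + Real.log (2 * Amax)))
    (κ : Type) [Fintype κ] (p : ℕ) (hp : p.Prime) (hp2 : p ≠ 2) (θ : κ → ℚ) (b : κ → ℤ)
    (A : κ → ℝ) (Amax W : ℝ) (hu : ∀ k, θ k ≠ 0 ∧ padicValRat p (θ k) = 0)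
    (hind : ∀ μ : κ → ℤ, ∏ k, θ k ^ μ k = 1 → μ = 0) (hAh : ∀ k, logHeight₁ (θ k) ≤ A k)
    (hA1 : ∀ k, (1 : ℝ) ≤ A k) (hAm : ∀ k, A k ≤ Amax) (hb : b ≠ 0)
    (hbW : ∀ k, Real.log (max 3 |(b k : ℝ)|) ≤ W) (hW1 : 1 ≤ W) :
    (padicValRat p (∏ k, θ k ^ b k - 1) : ℝ) * Real.log p ≤
      (max |c| 20) ^ Fintype.card κ * ((p : ℝ) / Real.log p) * (∏ k, A k) *
        (W + Real.log p + Real.log (2 * Amax)) := by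
  set r := Fintype.card κ with hr
  set e : κ ≃ Fin r := Fintype.equivFin κ with he
  have hind' : ∀ μ : Fin r → ℤ, ∏ i, (θ (e.symm i)) ^ μ i = 1 → μ = 0 := by
    intro μ hμ
    have h1 : ∏ k, θ k ^ μ (e k) = 1 := by
      rw [← hμ]; exact (Fintype.prod_equiv e _ _ fun k => by simp)
    have h2 := hind (fun k => μ (e k)) h1
    funext i
    have := congr_fun h2 (e.symm i)
    simpa using this
  obtain ⟨k₁, hk₁⟩ : ∃ k, b k ≠ 0 := by by_contra h; push Not at h; exact hb (funext h)
  have hb' : (fun i => b (e.symm i)) ≠ 0 := by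
    intro h; apply hk₁; have := congr_fun h (e k₁); simpa using this
  have h := hc p hp hp2 r (fun i => θ (e.symm i)) (fun i => b (e.symm i)) (fun i => A (e.symm i)) Amax W
    (fun i => hu _) hind' (fun i => hAh _) (fun i => hA1 _) (fun i => hAm _) hb' (fun i => hbW _) hW1
  rw [Fintype.prod_equiv e.symm (fun i => A (e.symm i)) A fun i => rfl, Fintype.prod_equiv e.symm
    (fun i => θ (e.symm i) ^ b (e.symm i)) (fun k => θ k ^ b k) fun i => rfl] at h
  -- `c^r ≤ |c|^r ≤ (max |c| 20)^r`, the other factors are `≥ 0`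
  have hp1 : (1 : ℝ) < p := by exact_mod_cast hp.one_lt
  have hAmax : 1 ≤ Amax := (hA1 k₁).trans (hAm k₁)
  have hG0 : 0 ≤ W + Real.log p + Real.log (2 * Amax) := by
    have := Real.log_pos hp1; have := Real.log_nonneg (show (1 : ℝ) ≤ 2 * Amax by linarith); linarith
  have hq0 : 0 ≤ (p : ℝ) / Real.log p := div_nonneg (by linarith) (Real.log_pos hp1).le
  have hP0 : 0 ≤ ∏ k, A k := Finset.prod_nonneg fun k _ => (lt_of_lt_of_le one_pos (hA1 k)).le
  have hpow : c ^ r ≤ (max |c| 20) ^ r :=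
    le_trans (le_abs_self _) (by rw [abs_pow]; exact pow_le_pow_left₀ (abs_nonneg c) (le_max_left _ _) r)
  have : c ^ r * ((p : ℝ) / Real.log p) * (∏ k, A k) * (W + Real.log p + Real.log (2 * Amax)) ≤
      (max |c| 20) ^ r * ((p : ℝ) / Real.log p) * (∏ k, A k) * (W + Real.log p + Real.log (2 * Amax)) :=
    mul_le_mul_of_nonneg_right (mul_le_mul_of_nonneg_right (mul_le_mul_of_nonneg_right hpow hq0) hP0) hG0
  linarith

end PadicShapeDepElim

open PadicShapeDepElim in
/-- **Dependence removal for the Kummer-free `p`-adic shape bound over `ℚ`, odd `p`**: the hypothesis is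
the planner's text of `PadicCoreOddRat` (route draft `YuMatveevShapeRat`) verbatim; the conclusion is the
same bound, constant `max |c| 20`, for all rational `p`-adic units with `∏ θᵢ^{mᵢ} ≠ 1` (no independence).
[cite: Matveev2000, §21 (pp. 173–176)] -/
theorem padicShape_dep_of_indep_odd
    (h : ∃ c : ℝ, ∀ (p : ℕ), p.Prime → p ≠ 2 →
      ∀ (r : ℕ) (θ : Fin r → ℚ) (m : Fin r → ℤ) (A : Fin r → ℝ) (Amax W : ℝ),
        (∀ i, θ i ≠ 0 ∧ padicValRat p (θ i) = 0) →
        (∀ μ : Fin r → ℤ, ∏ i, θ i ^ μ i = 1 → μ = 0) →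
        (∀ i, Height.logHeight₁ (θ i) ≤ A i) → (∀ i, 1 ≤ A i) → (∀ i, A i ≤ Amax) →
        m ≠ 0 → (∀ i, Real.log (max 3 (|m i| : ℝ)) ≤ W) → 1 ≤ W →
        (padicValRat p (∏ i, θ i ^ m i - 1) : ℝ) * Real.log p ≤
          c ^ r * ((p : ℝ) / Real.log p) * (∏ i, A i) * (W + Real.log p + Real.log (2 * Amax))) :
    ∃ c : ℝ, ∀ (p : ℕ), p.Prime → p ≠ 2 →
      ∀ (r : ℕ) (θ : Fin r → ℚ) (m : Fin r → ℤ) (A : Fin r → ℝ) (Amax W : ℝ),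
        (∀ i, θ i ≠ 0 ∧ padicValRat p (θ i) = 0) →
        (∀ i, Height.logHeight₁ (θ i) ≤ A i) → (∀ i, 1 ≤ A i) → (∀ i, A i ≤ Amax) →
        (∀ i, Real.log (max 3 (|m i| : ℝ)) ≤ W) → 1 ≤ W → ∏ i, θ i ^ m i ≠ 1 →
        (padicValRat p (∏ i, θ i ^ m i - 1) : ℝ) * Real.log p ≤
          c ^ r * ((p : ℝ) / Real.log p) * (∏ i, A i) * (W + Real.log p + Real.log (2 * Amax)) := by
  obtain ⟨c, hc⟩ := h
  exact ⟨max |c| 20, fun p hp hp2 r θ m A Amax W hu hAh hA1 hAm hmW hW1 hΞ =>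
    dep_elim_odd (C := max |c| 20) (le_max_right _ _) (core_fintype_odd hc) r (Fin r) (by simp) p hp hp2
      θ m A Amax W hu hAh hA1 hAm hmW hW1 hΞ⟩

end Summit.ABC.StewartYu

end
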